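import Literature.IUT.HodgeTheaters.PMBaseStrips
import Literature.IUT.HodgeTheaters.PMBaseKitModel
import HarnessLib

/-!
# [IUTchI] Remark 6.1.1 "`𝕍^± = 𝕍^{±un}`" — kernel record of the predicate `PMBaseKit.VpmEqVpmun`
# (FACT-LIST row F-2040)

Mochizuki, *Inter-universal Teichmüller theory I*, §6, Remark 6.1.1, kurims manuscript (May 2020)
p. 159: "in the notation of Example 4.3, (i); Definition 6.1, (v), it is not difficult to verify [cf.
Remark 3.1.2, (i)] that `𝕍^± = 𝕍^{±un} (⊆ 𝕍(K))`" ([IUTchI] Rmk 6.1.1 p.159)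
[claim: Mochizuki2012, status: disputed].

PROOF-ONLY companion of `PMBaseStrips.lean` (abc-iut-L5-t4, p405878; nothing there is edited or
restated) — abc-iut cell, F fact-proving wave, seat abc-iut-f-086 (tranche 192, re-pointed from
tranche 86 per plan C-R5b), FROZEN plan/FACT-LIST.md row **F-2040** `PMBaseKit.VpmEqVpmun`.

The trunk types Rmk 6.1.1 over the base kit `K` as the predicate

  `VpmEqVpmun VK sect Vpmun : Prop := {x : VK | ∃ α ∈ Aut_±(𝒟^{⊚±}), ∃ v, x = α • sect v} = Vpmun`

in which the set `𝕍(K)` (`VK`, with its `Aut(𝒟^{⊚±})`-action), the section `𝕍 ⊆ 𝕍(K)` (`sect`,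
[IUTchI] Def 3.1 (e)) AND the set `𝕍^{±un}` of Example 4.3 (i) (`Vpmun`) are FREE PARAMETERS (the
last one "TODO-merge(abc-iut-L5-t3)": the §4 definition of `𝕍^{±un}` is not wired in).  So the row is
a SCHEMA, not a fact (plan R1/R5): with `Vpmun` free the universal closure is trivially false, and the
printed equality becomes a theorem only once `Vpmun` is instantiated with the §4 object.  What the
kernel can record now:

* `vpmEqVpmun_iff` / `vpmEqVpmun_self` — the predicate holds for EXACTLY ONE value of the parameter,
  namely `Vpmun := 𝕍^±` itself (satisfiable at every kit: model witness);
* `VpmEqVpmun.unique`, `VpmEqVpmun.sect_mem`, `VpmEqVpmun.smul_mem` — consequences any instance must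
  satisfy (`𝕍^{±un}` contains the section `𝕍` and is `Aut_±`-stable), usable as sanity checks when the
  §4 object is plugged in;
* `not_vpmEqVpmun_empty` (every kit with a valuation) and `not_forall_vpmEqVpmun` — the universal
  closure is REFUTED, at abc-iut-L5-t4's toy kit `PMBaseKit.toyKit 3` (`𝕍 = Unit`) with
  `𝕍(K) := Aut(𝒟^{⊚±})` acting on itself, `sect := 1`, `Vpmun := ∅`.

No statement of [IUTchI] is strengthened or asserted; `[claim: Mochizuki2012, status: disputed]` stays
on the trunk declarations; nothing here bears on [IUTchIII] Cor. 3.12; typed ≠ proved except for the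
theorems below.
-/

namespace Literature.IUT.HodgeTheaters

open CategoryTheory

universe u

namespace PMBaseKit

variable {l : ℕ} {K : PMBaseKit.{u} l}

/-- Unfolding of the predicate: "`𝕍^± = 𝕍^{±un}`" holds for the parameter `Vpmun` iff `Vpmun` IS the
orbit set `𝕍^± = Aut_±(𝒟^{⊚±}) · 𝕍`. ([IUTchI] Rmk 6.1.1 p.159) [claim: Mochizuki2012, status: disputed] -/
theorem vpmEqVpmun_iff (VK : Type*) [MulAction (Aut K.gModel) VK] (sect : K.V → VK) (Vpmun : Set VK) :
    K.VpmEqVpmun VK sect Vpmun ↔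
      Vpmun = {x : VK | ∃ α ∈ K.autPMg K.gModel, ∃ v, x = α • sect v} :=
  eq_comm

/-- MODEL WITNESS (every kit, every `𝕍(K)`, every section): the predicate holds at `Vpmun := 𝕍^±`.
([IUTchI] Rmk 6.1.1 p.159) [claim: Mochizuki2012, status: disputed] -/
theorem vpmEqVpmun_self (VK : Type*) [MulAction (Aut K.gModel) VK] (sect : K.V → VK) :
    K.VpmEqVpmun VK sect {x : VK | ∃ α ∈ K.autPMg K.gModel, ∃ v, x = α • sect v} :=
  rfl

namespace VpmEqVpmun

variable {VK : Type*} [MulAction (Aut K.gModel) VK] {sect : K.V → VK} {Vpmun Vpmun' : Set VK}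

/-- The parameter is determined: two sets both equal to `𝕍^±` coincide.
([IUTchI] Rmk 6.1.1 p.159) [claim: Mochizuki2012, status: disputed] -/
theorem unique (h : K.VpmEqVpmun VK sect Vpmun) (h' : K.VpmEqVpmun VK sect Vpmun') : Vpmun = Vpmun' :=
  h.symm.trans h'

/-- Any `𝕍^{±un}` satisfying Rmk 6.1.1 contains the section `𝕍 ⊆ 𝕍(K)` (`1 ∈ Aut_±`).
([IUTchI] Rmk 6.1.1 p.159) [claim: Mochizuki2012, status: disputed] -/
theorem sect_mem (h : K.VpmEqVpmun VK sect Vpmun) (v : K.V) : sect v ∈ Vpmun := by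
  rw [← h]
  exact ⟨1, one_mem _, v, (one_smul _ _).symm⟩

/-- Any `𝕍^{±un}` satisfying Rmk 6.1.1 is stable under `Aut_±(𝒟^{⊚±})`.
([IUTchI] Rmk 6.1.1 p.159) [claim: Mochizuki2012, status: disputed] -/
theorem smul_mem (h : K.VpmEqVpmun VK sect Vpmun) {α : Aut K.gModel} (hα : α ∈ K.autPMg K.gModel)
    {x : VK} (hx : x ∈ Vpmun) : α • x ∈ Vpmun := by
  rw [← h] at hx ⊢
  obtain ⟨β, hβ, v, rfl⟩ := hx
  exact ⟨α * β, mul_mem hα hβ, v, (mul_smul _ _ _).symm⟩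

/-- Any `𝕍^{±un}` satisfying Rmk 6.1.1 is nonempty as soon as `𝕍` is.
([IUTchI] Rmk 6.1.1 p.159) [claim: Mochizuki2012, status: disputed] -/
theorem nonempty [Nonempty K.V] (h : K.VpmEqVpmun VK sect Vpmun) : Vpmun.Nonempty :=
  ⟨sect (Classical.arbitrary K.V), sect_mem h _⟩

end VpmEqVpmun

/-- At every kit with at least one valuation the predicate FAILS for the parameter `Vpmun := ∅`
(pointwise form of the refutation of the universal closure). ([IUTchI] Rmk 6.1.1 p.159)
[claim: Mochizuki2012, status: disputed] -/
theorem not_vpmEqVpmun_empty [Nonempty K.V] (VK : Type*) [MulAction (Aut K.gModel) VK]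
    (sect : K.V → VK) : ¬ K.VpmEqVpmun VK sect ∅ :=
  fun h => (VpmEqVpmun.nonempty h).ne_empty rfl

/-- **The universal closure of F-2040 is REFUTED**: at abc-iut-L5-t4's toy base kit
`PMBaseKit.toyKit 3` (one valuation, `𝕍 = Unit`), with `𝕍(K) := Aut(𝒟^{⊚±})` acting on itself by left
multiplication, the section `v ↦ 1` and `𝕍^{±un} := ∅`, the equality `𝕍^± = 𝕍^{±un}` fails.  So the row
is admissible only at the intended instance (`Vpmun :=` the `𝕍^{±un}` of Example 4.3 (i)), never as
`∀ VK sect Vpmun, …`. ([IUTchI] Rmk 6.1.1 p.159) [claim: Mochizuki2012, status: disputed] -/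
theorem not_forall_vpmEqVpmun :
    ¬ ∀ (l : ℕ) (K : PMBaseKit.{0} l) (VK : Type) [MulAction (Aut K.gModel) VK]
        (sect : K.V → VK) (Vpmun : Set VK), K.VpmEqVpmun VK sect Vpmun := by
  intro h
  haveI : Fact (Nat.Prime 3) := ⟨Nat.prime_three⟩
  have hl : (3 : ℕ) ≠ 2 := by decide
  haveI : Nonempty (toyKit 3 hl).V := ⟨PUnit.unit⟩
  exact not_vpmEqVpmun_empty (K := toyKit 3 hl) (Aut (toyKit 3 hl).gModel) (fun _ => 1)
    (h 3 (toyKit 3 hl) (Aut (toyKit 3 hl).gModel) (fun _ => 1) ∅)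

/-- Two-sided schema at one kit: at `toyKit 3` the predicate holds for `Vpmun := 𝕍^±` and fails for
`Vpmun := ∅`. ([IUTchI] Rmk 6.1.1 p.159) [claim: Mochizuki2012, status: disputed] -/
theorem exists_vpmEqVpmun_and_exists_not :
    ∃ (l : ℕ) (K : PMBaseKit.{0} l) (VK : Type) (_ : MulAction (Aut K.gModel) VK) (sect : K.V → VK),
      (∃ Vpmun : Set VK, K.VpmEqVpmun VK sect Vpmun) ∧ ∃ Vpmun : Set VK, ¬ K.VpmEqVpmun VK sect Vpmun := by
  haveI : Fact (Nat.Prime 3) := ⟨Nat.prime_three⟩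
  have hl : (3 : ℕ) ≠ 2 := by decide
  haveI : Nonempty (toyKit 3 hl).V := ⟨PUnit.unit⟩
  exact ⟨3, toyKit 3 hl, Aut (toyKit 3 hl).gModel, inferInstance, fun _ => 1,
    ⟨_, vpmEqVpmun_self _ _⟩, ⟨∅, not_vpmEqVpmun_empty _ _⟩⟩

end PMBaseKit

end Literature.IUT.HodgeTheaters
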